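import Summits.ResolutionOfSingularities.ResolutionOfSingularities.Theorems.EquisingularLiftEquisingularLiftNatDirectionOfSection
import Literature.AlgebraicGeometry.Hironaka2017.Lib.ReesAlgebraGlue
import Literature.AlgebraicGeometry.Resolution.MarkedIdealsLemmas
import HarnessLib

/-!
# [OURS · L1 W4.5(b) · EL♮(3)] T-DIRLIFT-UP route C, brick C3 — THE UPSTAIRS DIRECTION FROM CHART COLUMNS: `(A_a ℓ_a + B_a m_a) + I²` on two
# affine charts, glued to ONE ideal sheaf `𝒟` with `I·I ≤ 𝒟 ≤ I`, adapted quasi-regular 2-frames at EVERY point of the curve, and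
# `𝒟·𝒪_{G₀} = 𝒟̄` read off stalkwise

Crux chain w45b (cell `res-hironaka`, slot W4.5(b)), working crux **EL♮** = stmt-ResolutionOfSingularities-20038, child **EL♮(3)** =
stmt-ResolutionOfSingularities-20148, route EquisingularLift, line `sections`; rungs DIR₀₁ / TOWER₃ (Čech round). Object C3 of res-D-pv-051's
T-DIRLIFT-UP (`L/res-D-pv-051/TARGET-DIRLIFT.sig.md` 7aab4520d07b2a47 §2 route C; res-L1-w45b-plan-1 RULING 2026-08-27T19:14:55Z (D3) «stub-2 = C3»).
Written by res-L1-w45b-stub-2 g7 (interface announced STATUS 20:09:05Z). HONEST FRAMING: OURS; NOT a statement of any manuscript; AI-written,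
weaker than expert review. No `sorry`; standard axioms; DEF-FREE. `--supports stmt-ResolutionOfSingularities-20148 --as helper`.

WHAT. On a locally Noetherian scheme `X₀` with an ideal sheaf `I` (the in-carrier curve) and two affine charts `U 0, U 1 ⊇ supp I`, a section
`c a ∈ Γ(X₀, U a)` on each chart (in the application `c a = A_a ℓ_a + B_a m_a`, the lifted unimodular column of T-P1VB in the conormal frame):
* `stalkIdeal_chartModel` — the chart model `((c_a) + I(U_a)²)~_*` (tree `idealSheafOnOpen` pushed forward) has stalk `(c_a)_p + I_p²` at `p ∈ U_a`;
* **`exists_direction_of_chartSections`** — if the two models have the same stalks on `U 0 ∩ U 1` (the cocycle relation `c₀ ≡ u·c₁ mod I²`,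
  `u` a unit mod `I`, stalk form) and `c a ∈ I(U a)`, there is ONE ideal sheaf `𝒟` on `X₀` with `I·I ≤ 𝒟 ≤ I` and `𝒟_p = (c_a)_p + I_p²` on `U a`
  (tree `Lib/ReesAlgebraGlue.exists_idealSheafData_stalkIdeal_eq_of_compatible`, res-type-089's gluing `⨅ₐ (·|_{U a})_*`, plus unit stalks off
  `supp I`);
* `exists_adaptedFrame_of_isUnit` (ring lemma) / **`exists_adaptedFrame_of_chartColumn`** — at a point `p ∈ supp I ∩ U a` where `I(U a) = (ℓ, m)`
  with `(ℓ, m)_p` quasi-regular and the column `(A, B)` unimodular modulo `I` (so `A_p` or `B_p` is a unit), an ADAPTED quasi-regular 2-frame: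
  `c' = (ℓ + A⁻¹B m, m)` or `(m + B⁻¹A ℓ, ℓ)` with `(c' 0, c' 1) = I_p` and `𝒟_p = (c' 0) + (c' 1 ²)` — D3b/D4's `hdir` at EVERY point of the
  curve (not only the special ones: `exists_subschemeIso_directionCentre` p555056 needs them all);
* **`comap_eq_of_chartSections`** — `𝒟·𝒪_{G₀} = 𝒟̄` along the special fibre `j₀ : G₀ → X₀` as soon as `𝒟̄` has the reduced chart stalks
  `(j₀♯ c_a)_z + Ī_z²` on `j₀⁻¹ U a` and `Ī·Ī ≤ 𝒟̄` (res-D-pv-051's C1 data) — stalkwise (`ext_of_forall_stalkIdeal_eq`).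

References (index only): res-D-pv-051 TARGET-DIRLIFT(.sig.md / -UP.sig.lean 9b7825e935ffb8f7), C1 p561783 / C1a p562805 / C1b p563530; res-type-089
Lib/IdealSheafGlue + Lib/ReesAlgebraGlue (gluing with prescribed stalks); res-L1-w45b-stub-2 B0 …NatDirectionOfSection p556107
(`isQuasiRegular_reframe`). [cite: Hartshorne1977, Ch. II Ex. 1.22] [cite: Matsumura1987, §16 Definition p. 124] (index only).
-/

set_option linter.dupNamespace false -- mandated namespace `Summit.<Summit>.<Problem>` of this single-conjunct summit

noncomputable section

open CategoryTheory CategoryTheory.Limits AlgebraicGeometry TopologicalSpace Topology IsLocalRing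
open Literature.AlgebraicGeometry.Resolution
open Literature.AlgebraicGeometry.Hironaka2017.S02Preliminaries
open AlgebraicGeometry.Scheme.IdealSheafData

namespace Summit.ResolutionOfSingularities.ResolutionOfSingularities.Cruxes.EquisingularLiftNat.Sections

universe u

/-! ## Ring lemmas: the adapted frame -/

/-- `(d₀) + (d₀, d₁)² = (d₀) + (d₁²)`. [folklore] -/
theorem span_singleton_sup_sq_span_pair {R : Type u} [CommRing R] (d : Fin 2 → R) :
    Ideal.span {d 0} ⊔ Ideal.span (Set.range d) ^ 2 = Ideal.span {d 0} ⊔ Ideal.span {d 1 * d 1} := by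
  apply le_antisymm
  · refine sup_le le_sup_left ?_
    rw [pow_two, Ideal.span_mul_span', Ideal.span_le]
    rintro _ ⟨a, ⟨i, rfl⟩, b, ⟨j, rfl⟩, rfl⟩
    rcases Fin.exists_fin_two.mp ⟨i, rfl⟩ with hi | hi <;> rcases Fin.exists_fin_two.mp ⟨j, rfl⟩ with hj | hj <;>
      simp only [hi, hj, SetLike.mem_coe]
    · exact Ideal.mem_sup_left (Ideal.mul_mem_right _ _ (Ideal.mem_span_singleton_self _))
    · exact Ideal.mem_sup_left (Ideal.mul_mem_right _ _ (Ideal.mem_span_singleton_self _))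
    · exact Ideal.mem_sup_left (Ideal.mul_mem_left _ _ (Ideal.mem_span_singleton_self _))
    · exact Ideal.mem_sup_right (Ideal.mem_span_singleton_self _)
  · refine sup_le le_sup_left ?_
    rw [Ideal.span_singleton_le_iff_mem]
    refine Ideal.mem_sup_right ?_
    rw [pow_two]
    exact Ideal.mul_mem_mul (Ideal.subset_span ⟨1, rfl⟩) (Ideal.subset_span ⟨1, rfl⟩)

/-- **The adapted frame of a unimodular column.** For a quasi-regular pair `c = (ℓ, m)` and `A, B` with `A` or `B` a unit, there is a
quasi-regular pair `c'` spanning the same ideal with `(A ℓ + B m) + (ℓ, m)² = (c' 0) + (c' 1 ²)`: `c' = (ℓ + A⁻¹B m, m)` resp.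
`(m + B⁻¹A ℓ, ℓ)` (res-L1-w45b-stub-2's `isQuasiRegular_reframe`). [cite: Matsumura1987, §16 Definition p. 124] [OURS · L1 W4.5b · C3] -/
theorem exists_adaptedFrame_of_isUnit {R : Type u} [CommRing R] (c : Fin 2 → R) (hc : IsQuasiRegular c) (A B : R)
    (hAB : IsUnit A ∨ IsUnit B) :
    ∃ c' : Fin 2 → R, Ideal.span (Set.range c') = Ideal.span (Set.range c) ∧ IsQuasiRegular c' ∧
      Ideal.span {A * c 0 + B * c 1} ⊔ Ideal.span (Set.range c) ^ 2 = Ideal.span {c' 0} ⊔ Ideal.span {c' 1 * c' 1} := by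
  rcases hAB with hA | hB
  · obtain ⟨a, ha⟩ := hA.exists_left_inv
    refine ⟨![c 0 - (-(a * B)) * c 1, c 1], span_range_reframe_eq c 1 0 (by decide) _,
      isQuasiRegular_reframe c hc 1 0 (by decide) _, ?_⟩
    -- `A (ℓ + aB m) = A ℓ + B m` up to the unit `A`
    have h : A * c 0 + B * c 1 = A * (c 0 - (-(a * B)) * c 1) := by
      have : A * a = 1 := by rw [mul_comm]; exact ha
      calc A * c 0 + B * c 1 = A * c 0 + (A * a) * B * c 1 := by rw [this, one_mul]
        _ = A * (c 0 - (-(a * B)) * c 1) := by ring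
    rw [h, Ideal.span_singleton_mul_left_unit hA, ← span_range_reframe_eq c 1 0 (by decide) (-(a * B))]
    exact span_singleton_sup_sq_span_pair ![c 0 - (-(a * B)) * c 1, c 1]
  · obtain ⟨b, hb⟩ := hB.exists_left_inv
    refine ⟨![c 1 - (-(b * A)) * c 0, c 0], span_range_reframe_eq c 0 1 (by decide) _,
      isQuasiRegular_reframe c hc 0 1 (by decide) _, ?_⟩
    have h : A * c 0 + B * c 1 = B * (c 1 - (-(b * A)) * c 0) := by
      have : B * b = 1 := by rw [mul_comm]; exact hb
      calc A * c 0 + B * c 1 = (B * b) * A * c 0 + B * c 1 := by rw [this, one_mul]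
        _ = B * (c 1 - (-(b * A)) * c 0) := by ring
    rw [h, Ideal.span_singleton_mul_left_unit hB, ← span_range_reframe_eq c 0 1 (by decide) (-(b * A))]
    exact span_singleton_sup_sq_span_pair ![c 1 - (-(b * A)) * c 0, c 0]

/-- In a local ring, if `x A + y B - 1` lies in a proper ideal then `A` or `B` is a unit. [folklore] -/
theorem isUnit_or_isUnit_of_sub_one_mem {R : Type u} [CommRing R] [IsLocalRing R] {J : Ideal R} (hJ : J ≠ ⊤)
    {x y A B : R} (h : x * A + y * B - 1 ∈ J) : IsUnit A ∨ IsUnit B := by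
  have hu : IsUnit (x * A + y * B) := by
    by_contra hnu
    have h1 : x * A + y * B ∈ maximalIdeal R := (mem_maximalIdeal _).mpr hnu
    have h2 : x * A + y * B - 1 ∈ maximalIdeal R := le_maximalIdeal hJ h
    have : (1 : R) ∈ maximalIdeal R := by
      have := Ideal.sub_mem _ h1 h2; rwa [sub_sub_cancel] at this
    exact (maximalIdeal.isMaximal R).ne_top (Ideal.eq_top_of_isUnit_mem _ this isUnit_one)
  rcases isUnit_or_isUnit_of_isUnit_add hu with h | h
  · exact Or.inl (isUnit_of_mul_isUnit_right h)
  · exact Or.inr (isUnit_of_mul_isUnit_right h)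

/-! ## The chart models and the glued direction -/

section ChartColumns

variable {X₀ : Scheme.{u}} [IsLocallyNoetherian X₀] (I : X₀.IdealSheafData) (U : Fin 2 → X₀.affineOpens)
  (c : ∀ a : Fin 2, Γ(X₀, U a))

/-- **Stalks of the chart model**: the push-forward to `X₀` of the ideal sheaf `((c_a) + I(U_a)²)~` on the affine chart `U a` has stalk
`(c_a)_p + I_p²` at every `p ∈ U a`. [cite: Hartshorne1977, Ch. II Prop. 5.4] [OURS · L1 W4.5b · C3] -/
theorem stalkIdeal_chartModel (a : Fin 2) {p : X₀} (hp : p ∈ (U a : X₀.Opens)) :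
    stalkIdeal ((Hironaka2005.idealSheafOnOpen (U a) (Ideal.span {c a} ⊔ I.ideal (U a) ^ 2)).map (U a : X₀.Opens).ι) p =
      Ideal.span {(X₀.presheaf.germ (U a) p hp).hom (c a)} ⊔ stalkIdeal I p ^ 2 := by
  rw [stalkIdeal_map_idealSheafOnOpen (U a) _ hp, Ideal.map_sup, Ideal.map_span, Set.image_singleton, Ideal.map_pow,
    ← stalkIdeal_eq_map_germ I (U a) hp]

/-- **C3, the glued direction.** Two chart sections `c a ∈ I(U a)` on affine charts `U 0, U 1 ⊇ supp I` whose chart models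
`(c_a) + I²` have the SAME STALKS on `U 0 ∩ U 1` (the cocycle relation) glue to one ideal sheaf `𝒟` on `X₀` with `I·I ≤ 𝒟 ≤ I` and
`𝒟_p = (c_a)_p + I_p²` on `U a`. [cite: Hartshorne1977, Ch. II Ex. 1.22] [OURS · L1 W4.5b · T-DIRLIFT-UP C3] toward
`stub_elnat_ratDirZeroPointResolution` / `stub_elnat_coneTowerPointResolution` (stmt-ResolutionOfSingularities-20148); NOT a statement of the
manuscript. -/
theorem exists_direction_of_chartSections (hcov : (I.support : Set X₀) ⊆ (U 0 : X₀.Opens) ∪ (U 1 : X₀.Opens))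
    (hcI : ∀ a, c a ∈ I.ideal (U a))
    (hcompat : ∀ (p : X₀) (h0 : p ∈ (U 0 : X₀.Opens)) (h1 : p ∈ (U 1 : X₀.Opens)),
      Ideal.span {(X₀.presheaf.germ (U 0) p h0).hom (c 0)} ⊔ stalkIdeal I p ^ 2 =
        Ideal.span {(X₀.presheaf.germ (U 1) p h1).hom (c 1)} ⊔ stalkIdeal I p ^ 2) :
    ∃ 𝒟 : X₀.IdealSheafData, I * I ≤ 𝒟 ∧ 𝒟 ≤ I ∧
      ∀ (a : Fin 2) (p : X₀) (hp : p ∈ (U a : X₀.Opens)),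
        stalkIdeal 𝒟 p = Ideal.span {(X₀.presheaf.germ (U a) p hp).hom (c a)} ⊔ stalkIdeal I p ^ 2 := by
  classical
  -- the chart models, pushed forward to `X₀`
  let N : Fin 2 → X₀.IdealSheafData := fun a =>
    (Hironaka2005.idealSheafOnOpen (U a) (Ideal.span {c a} ⊔ I.ideal (U a) ^ 2)).map (U a : X₀.Opens).ι
  have hN : ∀ (a : Fin 2) {p : X₀} (hp : p ∈ (U a : X₀.Opens)),
      stalkIdeal (N a) p = Ideal.span {(X₀.presheaf.germ (U a) p hp).hom (c a)} ⊔ stalkIdeal I p ^ 2 :=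
    fun a p hp => stalkIdeal_chartModel I U c a hp
  -- same stalks on the overlap
  have hcompat' : ∀ (j k : Fin 2), ∀ p ∈ (U j : X₀.Opens) ⊓ (U k : X₀.Opens), stalkIdeal (N j) p = stalkIdeal (N k) p := by
    intro j k p hp
    obtain ⟨hj, hk⟩ := hp
    rw [hN j hj, hN k hk]
    rcases Fin.exists_fin_two.mp ⟨j, rfl⟩ with rfl | rfl <;> rcases Fin.exists_fin_two.mp ⟨k, rfl⟩ with rfl | rfl
    · rfl
    · exact hcompat p hj hk
    · exact (hcompat p hk hj).symm
    · rfl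
  -- glue (res-type-089's `⨅ₐ (·|_{U a})_*` with prescribed stalks)
  obtain ⟨G, hG, hG₀⟩ := exists_idealSheafData_stalkIdeal_eq_of_compatible (fun a : Fin 2 => (U a : X₀.Opens)) N hcompat'
  -- off the charts: unit stalks (the charts cover `supp I`)
  have hoff : ∀ p : X₀, p ∉ (U 0 : X₀.Opens) → p ∉ (U 1 : X₀.Opens) → stalkIdeal I p = ⊤ ∧ stalkIdeal G p = ⊤ := by
    intro p h0 h1
    have hps : p ∉ I.support := fun h => by
      rcases hcov h with h' | h'
      · exact h0 h'
      · exact h1 h'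
    refine ⟨stalkIdeal_eq_top_of_not_mem_support hps, ?_⟩
    refine hG₀ I.support.compl ?_ p hps
    intro a q hq
    obtain ⟨hqa, hqs⟩ := hq
    rw [hN a hqa, stalkIdeal_eq_top_of_not_mem_support hqs, pow_two, Ideal.top_mul]
    exact sup_top_eq _
  refine ⟨G, ?_, ?_, ?_⟩
  · -- `I·I ≤ 𝒟`
    refine le_of_forall_stalkIdeal_le fun p => ?_
    rw [stalkIdeal_mul, ← pow_two]
    by_cases h0 : p ∈ (U 0 : X₀.Opens)
    · rw [hG 0 p h0, hN 0 h0]; exact le_sup_right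
    by_cases h1 : p ∈ (U 1 : X₀.Opens)
    · rw [hG 1 p h1, hN 1 h1]; exact le_sup_right
    · rw [(hoff p h0 h1).2]; exact le_top
  · -- `𝒟 ≤ I`
    refine le_of_forall_stalkIdeal_le fun p => ?_
    have hle : ∀ (a : Fin 2) (hp : p ∈ (U a : X₀.Opens)),
        Ideal.span {(X₀.presheaf.germ (U a) p hp).hom (c a)} ⊔ stalkIdeal I p ^ 2 ≤ stalkIdeal I p := by
      intro a hp
      refine sup_le ?_ ?_
      · rw [Ideal.span_singleton_le_iff_mem, stalkIdeal_eq_map_germ I (U a) hp]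
        exact Ideal.mem_map_of_mem _ (hcI a)
      · rw [pow_two]; exact Ideal.mul_le_right
    by_cases h0 : p ∈ (U 0 : X₀.Opens)
    · rw [hG 0 p h0, hN 0 h0]; exact hle 0 h0
    by_cases h1 : p ∈ (U 1 : X₀.Opens)
    · rw [hG 1 p h1, hN 1 h1]; exact hle 1 h1
    · rw [(hoff p h0 h1).1]; exact le_top
  · intro a p hp
    rw [hG a p hp, hN a hp]

omit [IsLocallyNoetherian X₀] in
/-- **The adapted frame at a point of the curve** (D3b/D4's `hdir`, at EVERY point of `supp I ∩ U a`): with `I(U a) = (ℓ, m)`, the pair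
`(ℓ, m)_p` quasi-regular, the column `(A, B)` unimodular modulo `I(U a)` (`x A + y B − 1 ∈ I(U a)`), and `𝒟_p = (A ℓ + B m)_p + I_p²`, there
is a quasi-regular 2-frame `c'` of `I_p` with `𝒟_p = (c' 0) + (c' 1 ²)`. [cite: Matsumura1987, §16 Definition p. 124] [OURS · L1 W4.5b · C3] -/
theorem exists_adaptedFrame_of_chartColumn (a : Fin 2) (ℓ m A B x y : Γ(X₀, U a)) (𝒟 : X₀.IdealSheafData)
    (hgen : I.ideal (U a) = Ideal.span {ℓ, m}) (hunimod : x * A + y * B - 1 ∈ I.ideal (U a))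
    {p : X₀} (hp : p ∈ (U a : X₀.Opens)) (hps : p ∈ I.support)
    (hfr : IsQuasiRegular ![(X₀.presheaf.germ (U a) p hp).hom ℓ, (X₀.presheaf.germ (U a) p hp).hom m])
    (h𝒟 : stalkIdeal 𝒟 p = Ideal.span {(X₀.presheaf.germ (U a) p hp).hom (A * ℓ + B * m)} ⊔ stalkIdeal I p ^ 2) :
    ∃ c' : Fin 2 → X₀.presheaf.stalk p, Ideal.span (Set.range c') = stalkIdeal I p ∧ IsQuasiRegular c' ∧
      stalkIdeal 𝒟 p = Ideal.span {c' 0} ⊔ Ideal.span {c' 1 * c' 1} := by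
  set φ := (X₀.presheaf.germ (U a) p hp).hom with hφ
  have hIp : stalkIdeal I p = Ideal.span (Set.range ![φ ℓ, φ m]) := by
    rw [stalkIdeal_eq_map_germ I (U a) hp, hgen, Ideal.map_span, Set.image_pair]
    congr 1
    ext t
    simp only [Set.mem_insert_iff, Set.mem_singleton_iff, Set.mem_range]
    constructor
    · rintro (rfl | rfl)
      · exact ⟨0, rfl⟩
      · exact ⟨1, rfl⟩
    · rintro ⟨i, rfl⟩
      rcases Fin.exists_fin_two.mp ⟨i, rfl⟩ with rfl | rfl
      · exact Or.inl rfl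
      · exact Or.inr rfl
  -- `A_p` or `B_p` is a unit (the stalk ideal is proper at a point of the support)
  have hne : stalkIdeal I p ≠ ⊤ := (mem_support_iff_stalkIdeal_le I p).mp hps |>.trans_lt
    (lt_top_iff_ne_top.mpr (maximalIdeal.isMaximal _).ne_top) |>.ne
  have hAB : IsUnit (φ A) ∨ IsUnit (φ B) := by
    refine isUnit_or_isUnit_of_sub_one_mem hne (x := φ x) (y := φ y) ?_
    have : φ (x * A + y * B - 1) ∈ stalkIdeal I p := by
      rw [stalkIdeal_eq_map_germ I (U a) hp]; exact Ideal.mem_map_of_mem _ hunimod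
    simpa only [map_sub, map_add, map_mul, map_one] using this
  obtain ⟨c', hspan, hqr, heq⟩ := exists_adaptedFrame_of_isUnit _ hfr (φ A) (φ B) hAB
  refine ⟨c', by rw [hspan, hIp], hqr, ?_⟩
  rw [h𝒟, hIp, ← heq]
  simp only [Matrix.cons_val_zero, Matrix.cons_val_one, map_add, map_mul]

/-- **C3 packaged (the interface announced 2026-08-27T20:09Z).** Charts `U 0, U 1 ⊇ supp I` with frames `I(U a) = (ℓ_a, m_a)` quasi-regular at
the points of the curve, and LIFTED COLUMNS `(A_a, B_a)` unimodular modulo `I` (`x_a A_a + y_a B_a − 1 ∈ I(U a)`) whose directions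
`(A_a ℓ_a + B_a m_a) + I²` have the same stalks on the overlap: ONE direction `𝒟` on `X₀` with `I·I ≤ 𝒟 ≤ I`, the chart stalks, and an
adapted quasi-regular 2-frame at EVERY point of `supp I`. [cite: Hartshorne1977, Ch. II Ex. 1.22] [cite: Matsumura1987, §16 Definition p. 124]
[OURS · L1 W4.5b · T-DIRLIFT-UP C3] toward `stub_elnat_ratDirZeroPointResolution` / `stub_elnat_coneTowerPointResolution`; NOT a statement of
the manuscript. -/
theorem exists_direction_of_chartColumns (hcov : (I.support : Set X₀) ⊆ (U 0 : X₀.Opens) ∪ (U 1 : X₀.Opens))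
    (ℓ m A B x y : ∀ a : Fin 2, Γ(X₀, U a))
    (hgen : ∀ a, I.ideal (U a) = Ideal.span {ℓ a, m a})
    (hfr : ∀ (a : Fin 2) (p : X₀) (hp : p ∈ (U a : X₀.Opens)), p ∈ I.support →
      IsQuasiRegular ![(X₀.presheaf.germ (U a) p hp).hom (ℓ a), (X₀.presheaf.germ (U a) p hp).hom (m a)])
    (hunimod : ∀ a, x a * A a + y a * B a - 1 ∈ I.ideal (U a))
    (hcompat : ∀ (p : X₀) (h0 : p ∈ (U 0 : X₀.Opens)) (h1 : p ∈ (U 1 : X₀.Opens)),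
      Ideal.span {(X₀.presheaf.germ (U 0) p h0).hom (A 0 * ℓ 0 + B 0 * m 0)} ⊔ stalkIdeal I p ^ 2 =
        Ideal.span {(X₀.presheaf.germ (U 1) p h1).hom (A 1 * ℓ 1 + B 1 * m 1)} ⊔ stalkIdeal I p ^ 2) :
    ∃ 𝒟 : X₀.IdealSheafData, I * I ≤ 𝒟 ∧ 𝒟 ≤ I ∧
      (∀ (a : Fin 2) (p : X₀) (hp : p ∈ (U a : X₀.Opens)),
        stalkIdeal 𝒟 p = Ideal.span {(X₀.presheaf.germ (U a) p hp).hom (A a * ℓ a + B a * m a)} ⊔ stalkIdeal I p ^ 2) ∧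
      ∀ p ∈ I.support, ∃ c' : Fin 2 → X₀.presheaf.stalk p,
        Ideal.span (Set.range c') = stalkIdeal I p ∧ IsQuasiRegular c' ∧ stalkIdeal 𝒟 p = Ideal.span {c' 0} ⊔ Ideal.span {c' 1 * c' 1} := by
  have hcI : ∀ a, A a * ℓ a + B a * m a ∈ I.ideal (U a) := fun a => by
    rw [hgen a]
    exact Ideal.add_mem _ (Ideal.mul_mem_left _ _ (Ideal.subset_span (Set.mem_insert _ _)))
      (Ideal.mul_mem_left _ _ (Ideal.subset_span (Set.mem_insert_of_mem _ rfl)))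
  obtain ⟨𝒟, hII, hI, h𝒟⟩ := exists_direction_of_chartSections I U (fun a => A a * ℓ a + B a * m a) hcov hcI hcompat
  refine ⟨𝒟, hII, hI, h𝒟, fun p hps => ?_⟩
  obtain ⟨a, hp⟩ : ∃ a : Fin 2, p ∈ (U a : X₀.Opens) := by
    rcases hcov hps with h | h
    · exact ⟨0, h⟩
    · exact ⟨1, h⟩
  exact exists_adaptedFrame_of_chartColumn I U a (ℓ a) (m a) (A a) (B a) (x a) (y a) 𝒟 (hgen a) (hunimod a) hp hps
    (hfr a p hp hps) (h𝒟 a p hp)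

end ChartColumns

/-! ## The reduced direction along the special fibre -/

/-- **`𝒟·𝒪_{G₀} = 𝒟̄` from the chart stalks.** Along `j₀ : G₀ → X₀`, if `𝒟` has chart stalks `(c_a)_p + I_p²` on charts covering `supp I`
(with `I·I ≤ 𝒟`) and `𝒟̄` has the reduced chart stalks `(j₀♯ c_a)_z + Ī_z²` on `j₀⁻¹ U a` with `Ī·Ī ≤ 𝒟̄` (`Ī = I·𝒪_{G₀}`), then
`𝒟·𝒪_{G₀} = 𝒟̄`. [OURS · L1 W4.5b · C3; stalkwise] -/
theorem comap_eq_of_chartSections {X₀ G₀ : Scheme.{u}} (j₀ : G₀ ⟶ X₀) (I 𝒟 : X₀.IdealSheafData) (𝒟' : G₀.IdealSheafData)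
    (U : Fin 2 → X₀.affineOpens) (c : ∀ a : Fin 2, Γ(X₀, U a))
    (hcov : (I.support : Set X₀) ⊆ (U 0 : X₀.Opens) ∪ (U 1 : X₀.Opens)) (hII : I * I ≤ 𝒟)
    (h𝒟 : ∀ (a : Fin 2) (p : X₀) (hp : p ∈ (U a : X₀.Opens)),
      stalkIdeal 𝒟 p = Ideal.span {(X₀.presheaf.germ (U a) p hp).hom (c a)} ⊔ stalkIdeal I p ^ 2)
    (hII' : I.comap j₀ * I.comap j₀ ≤ 𝒟')
    (h𝒟' : ∀ (a : Fin 2) (z : G₀) (hz : j₀ z ∈ (U a : X₀.Opens)),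
      stalkIdeal 𝒟' z = Ideal.span {(j₀.stalkMap z).hom ((X₀.presheaf.germ (U a) (j₀ z) hz).hom (c a))} ⊔
        stalkIdeal (I.comap j₀) z ^ 2) :
    𝒟.comap j₀ = 𝒟' := by
  refine ext_of_forall_stalkIdeal_eq fun z => ?_
  rw [stalkIdeal_comap_eq_map_stalkMap]
  by_cases h : j₀ z ∈ (U 0 : X₀.Opens) ∨ j₀ z ∈ (U 1 : X₀.Opens)
  · obtain ⟨a, ha⟩ : ∃ a : Fin 2, j₀ z ∈ (U a : X₀.Opens) := by
      rcases h with h | h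
      · exact ⟨0, h⟩
      · exact ⟨1, h⟩
    rw [h𝒟 a _ ha, h𝒟' a z ha, Ideal.map_sup, Ideal.map_span, Set.image_singleton, Ideal.map_pow, ← stalkIdeal_comap_eq_map_stalkMap]
  · push Not at h
    have hps : j₀ z ∉ I.support := fun h' => by
      rcases hcov h' with h' | h'
      · exact h.1 h'
      · exact h.2 h'
    have hI : stalkIdeal I (j₀ z) = ⊤ := stalkIdeal_eq_top_of_not_mem_support hps
    have h1 : stalkIdeal 𝒟 (j₀ z) = ⊤ := by
      rw [eq_top_iff]
      calc (⊤ : Ideal _) = stalkIdeal I (j₀ z) * stalkIdeal I (j₀ z) := by rw [hI, Ideal.top_mul]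
        _ = stalkIdeal (I * I) (j₀ z) := (stalkIdeal_mul I I _).symm
        _ ≤ stalkIdeal 𝒟 (j₀ z) := stalkIdeal_mono hII _
    have hI' : stalkIdeal (I.comap j₀) z = ⊤ := by
      rw [stalkIdeal_comap_eq_map_stalkMap, hI, Ideal.map_top]
    have h2 : stalkIdeal 𝒟' z = ⊤ := by
      rw [eq_top_iff]
      calc (⊤ : Ideal _) = stalkIdeal (I.comap j₀) z * stalkIdeal (I.comap j₀) z := by rw [hI', Ideal.top_mul]
        _ = stalkIdeal (I.comap j₀ * I.comap j₀) z := (stalkIdeal_mul _ _ _).symm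
        _ ≤ stalkIdeal 𝒟' z := stalkIdeal_mono hII' _
    rw [h1, h2, Ideal.map_top]

end Summit.ResolutionOfSingularities.ResolutionOfSingularities.Cruxes.EquisingularLiftNat.Sections

end
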